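/-
Copyright (c) 2026 the pub-hodgecm-mathlib formalisation cell (harness21).  Prover seat hodgecm-mathlib-K2E4-p10 (g5), Track B ∕ K2-LIT, h413 =
`stmt-HodgeConjecture-24833`, ENGINE E1, campaign «EIS-R7-BL», deal «BL-P2» → P2a (dealer K2E1-plan (g5) 09:01:41Z: «Claim 4 bullets minus ι: completeness ∕ restriction ∕
`HNcusp` closed …»), FILE A: the STRUCTURAL half of Bernstein–Lapid's Claim 4 over ★ `K2E1BLBorelSpacesU2Defs` (p858761).
-/
import Summits.HodgeConjecture.HodgeConjecture.Theorems.K2E1BLBorelSpacesU2Defs     -- ★ p858761 (this seat): `HN`, `restrHN`, `cnstN` (= condExpL2), `HNcusp`, `HX`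
import HarnessLib

/-!
# K2·E1 — `K2E1BLSpacesU2` (P2a, FILE A): THE BERNSTEIN–LAPID SPACES ARE HILBERT, THE RESTRICTIONS ARE FUNCTORIAL CONTRACTIONS, `cnst_k` IS A SELF-ADJOINT IDEMPOTENT CONTRACTION,
# `𝓗_k(Z_c)^cusp` IS A CLOSED COMPLETE SUBSPACE WITH `f = (f − cnst f) + cnst f`, `f − cnst f ∈ 𝓗^cusp`

Track B ∕ K2-LIT, crux h413 = `stmt-HodgeConjecture-24833`, route of record `HCCMUnconditional`; cell `hodgecm-mathlib`, squad K2, ENGINE E1.  THEOREMS ONLY (no `def`, no instance,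
no notation, no named-fact hypothesis, no `sorry`); lane `--supports stmt-HodgeConjecture-24833 --as helper` (count-neutral).  Closes no socket.  GENERIC rank `N` (clone discipline);
NO measure letter is needed here (everything holds for an arbitrary measure `μZ` on `Z = B(F)∖G(𝔸)`); the ι-half of Claim 4 (bounds, closed range — letters `hμZ`, `hβ` of
RULING D2 08:59:22Z) is K2E1-p08's «P2a-ι», the identification `cnst_k = fibre average` is P2b.

THE MATHEMATICS [BernsteinLapid2019, §4 Claim 4 (p. 10); MoeglinWaldspurger1995, I.2.6, I.2.13].  With `𝓗_k(Z_c) = L²(Z_c; H^{−2k}μZ)` (★ `HN`) and `cnst_k` = the conditional expectation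
w.r.t. the `N(𝔸)B(F)`-invariant σ-algebra (★ `cnstN`, Mathlib `condExpL2` = orthogonal projection onto `lpMeas`): (i) `𝓗_k(Z_c)`, `𝓗_k(𝔛)` are COMPLETE inner-product spaces
(Mathlib `Lp` at `p = 2`); (ii) the restriction `𝓗_k(Z_c) → 𝓗_k(Z_{c₀})` is the identity at `c₀ = c`, transitive in `c ≤ c₀ ≤ c₁`, of norm `≤ 1` (Claim 4 bullet 2's structural part);
(iii) `cnst_k` is IDEMPOTENT, SELF-ADJOINT and a CONTRACTION, fixes exactly the `N(𝔸)`-invariant classes, and `f − cnst_k f ∈ ker cnst_k = 𝓗_k(Z_c)^cusp` (Claim 4 bullets 3–4,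
structural part); (iv) `𝓗_k(Z_c)^cusp` is closed and complete (the domain of the compact operator of Claim 5 ∕ K2).
* §1 completeness: `completeSpace_HN`, `completeSpace_HX`, `completeSpace_HNcusp`.
* §2 restriction: `restrHN_self`, `restrHN_trans`, `norm_restrHN_le`, `coeFn_restrHN`.
* §3 the projection: `cnstN_idem`, `inner_cnstN_left_eq_right`, `norm_cnstN_le`, `cnstN_eq_self_of_mem_lpMeas`, `sub_cnstN_mem_HNcusp`, `cnstN_mem_HNcusp_iff`, `eq_cusp_add_cnst`.
HONEST LABEL: HC_CM is proved only modulo the 7 printed citations (2 remaining named inputs: hLiu418 = `stmt-HodgeConjecture-24832`, h413 = `stmt-HodgeConjecture-24833`) until rung 0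
closes; this file asserts no named fact and closes no socket; count-neutral.
References: [BernsteinLapid2019] arXiv:1911.02342 §4 Claim 4 p. 10 · [MoeglinWaldspurger1995] I.2.6, I.2.13.
-/

set_option autoImplicit false
set_option linter.dupNamespace false -- the mandated namespace repeats `HodgeConjecture.HodgeConjecture`

noncomputable section

open MeasureTheory NumberField IsDedekindDomain Filter Topology
open scoped NNReal ENNReal
open Literature.NumberTheory.Automorphic Literature.NumberTheory.Automorphic.UnitaryGroup AdelicGroupData
open Summit.HodgeConjecture.HodgeConjecture.Cruxes.H413.K2E1BLBorelSpacesU2Defs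

namespace Summit.HodgeConjecture.HodgeConjecture.Cruxes.H413.K2E1BLSpacesU2

variable {F E : Type} [Field F] [NumberField F] [Field E] [NumberField E] [Algebra F E] {c : E ≃ₐ[F] E} {N : ℕ} [NeZero N]
  {k : ℕ} {c₁ : ℝ≥0} {μZ : Measure (borelQuotient F E c N)}

/-! ## §1 Completeness (Claim 4: «Hilbert space `𝓗_N(Z_c)`», Banach targets for the closed-embedding statement) -/

/-- `𝓗_k(Z_c)` is complete (Mathlib: `Lp` is complete). [cite: BernsteinLapid2019, §4 Claim 4 p. 10] -/
theorem completeSpace_HN (k : ℕ) (c₁ : ℝ≥0) (μZ : Measure (borelQuotient F E c N)) : CompleteSpace (HN F E c N k c₁ μZ) := inferInstance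

/-- `𝓗_k(𝔛)` is complete. [cite: BernsteinLapid2019, §4 Claim 4 p. 10] -/
theorem completeSpace_HX (k : ℕ) (μ : Measure (quasiSplit F E c N).automorphicQuotient) : CompleteSpace (HX F E c N k μ) := inferInstance

/-- `𝓗_k(Z_c)^cusp = ker cnst_k` is complete (closed subspace of a complete space, ★ `isClosed_HNcusp`). [cite: BernsteinLapid2019, §4 Claim 5 p. 10] -/
theorem completeSpace_HNcusp (k : ℕ) (c₁ : ℝ≥0) (μZ : Measure (borelQuotient F E c N)) : CompleteSpace (HNcusp F E c N k c₁ μZ) :=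
  (isClosed_HNcusp F E c N k c₁ μZ).completeSpace_coe

/-! ## §2 The restriction maps: identity at `c₀ = c`, transitive, contractions (Claim 4 bullet 2, structural part) -/

/-- `restr f =ᵐ f` w.r.t. the smaller measure. [cite: BernsteinLapid2019, §4 Claim 4 p. 10] -/
theorem coeFn_restrHN {c₀ : ℝ≥0} (h : c₁ ≤ c₀) (f : HN F E c N k c₁ μZ) :
    (restrHN F E c N k h μZ f : borelQuotient F E c N → ℂ) =ᵐ[weightedTruncMeasure F E c N k c₀ μZ] (f : borelQuotient F E c N → ℂ) := by
  rw [restrHN_apply]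
  exact (memLp_restrict F E c N k h μZ f).coeFn_toLp

/-- **`restr_{c,c} = id`**. [cite: BernsteinLapid2019, §4 Claim 4 p. 10] -/
theorem restrHN_self (f : HN F E c N k c₁ μZ) : restrHN F E c N k (le_refl c₁) μZ f = f := by
  rw [restrHN_apply]
  exact Lp.toLp_coeFn f _

/-- **Transitivity `restr_{c₀,c₂} ∘ restr_{c,c₀} = restr_{c,c₂}`** (`c ≤ c₀ ≤ c₂`). [cite: BernsteinLapid2019, §4 Claim 4 p. 10] -/
theorem restrHN_trans {c₀ c₂ : ℝ≥0} (h : c₁ ≤ c₀) (h' : c₀ ≤ c₂) (f : HN F E c N k c₁ μZ) :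
    restrHN F E c N k h' μZ (restrHN F E c N k h μZ f) = restrHN F E c N k (h.trans h') μZ f := by
  rw [restrHN_apply, restrHN_apply]
  exact MemLp.toLp_congr (memLp_restrict F E c N k h' μZ (restrHN F E c N k h μZ f)) (memLp_restrict F E c N k (h.trans h') μZ f)
    ((weightedTruncMeasure_absolutelyContinuous F E c N k h' μZ).ae_le (coeFn_restrHN h f))

/-- The restriction is a contraction: `‖restr f‖ ≤ ‖f‖`. [cite: BernsteinLapid2019, §4 Claim 4 p. 10] -/
theorem norm_restrHN_le {c₀ : ℝ≥0} (h : c₁ ≤ c₀) (f : HN F E c N k c₁ μZ) : ‖restrHN F E c N k h μZ f‖ ≤ ‖f‖ :=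
  norm_restrLin_le F E c N k h μZ f

/-! ## §3 `cnst_k`: idempotent, self-adjoint contraction; `f − cnst f ∈ 𝓗^cusp`; `f = (f − cnst f) + cnst f` (Claim 4 bullets 3–4, structural part) -/

/-- `cnst_k` fixes the `N(𝔸)`-invariant classes: `f ∈ lpMeas(mN) ⇒ cnst_k f = f`. [cite: BernsteinLapid2019, §4 Claim 4 p. 10] -/
theorem cnstN_eq_self_of_mem_lpMeas {f : HN F E c N k c₁ μZ} (hf : f ∈ lpMeas ℂ ℂ (invariantSigma F E c N) 2 (weightedTruncMeasure F E c N k c₁ μZ)) :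
    cnstN F E c N k c₁ μZ f = f := by
  haveI : Fact (invariantSigma F E c N ≤ instMeasurableSpaceBorelQuotient F E c N) := ⟨invariantSigma_le F E c N⟩
  rw [cnstN_apply]
  have h := Submodule.orthogonalProjectionOnto_mem_subspace_eq_self (K := lpMeas ℂ ℂ (invariantSigma F E c N) 2 (weightedTruncMeasure F E c N k c₁ μZ)) ⟨f, hf⟩
  exact congrArg Subtype.val h

/-- **`cnst_k` is idempotent**: `cnst (cnst f) = cnst f`. [cite: BernsteinLapid2019, §4 Claim 4 p. 10] -/
theorem cnstN_idem (f : HN F E c N k c₁ μZ) : cnstN F E c N k c₁ μZ (cnstN F E c N k c₁ μZ f) = cnstN F E c N k c₁ μZ f :=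
  cnstN_eq_self_of_mem_lpMeas (cnstN_mem_lpMeas F E c N k c₁ μZ f)

/-- **`cnst_k` is self-adjoint**: `⟪cnst f, g⟫ = ⟪f, cnst g⟫` (Mathlib `inner_condExpL2_left_eq_right`). [cite: BernsteinLapid2019, §4 Claim 4 p. 10] -/
theorem inner_cnstN_left_eq_right (f g : HN F E c N k c₁ μZ) :
    @inner ℂ _ _ (cnstN F E c N k c₁ μZ f) g = @inner ℂ _ _ f (cnstN F E c N k c₁ μZ g) := by
  rw [cnstN_apply, cnstN_apply]
  exact inner_condExpL2_left_eq_right (invariantSigma_le F E c N)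

/-- **`cnst_k` is a contraction**: `‖cnst f‖ ≤ ‖f‖` (Mathlib `norm_condExpL2_le`). [cite: BernsteinLapid2019, §4 Claim 4 p. 10] -/
theorem norm_cnstN_le (f : HN F E c N k c₁ μZ) : ‖cnstN F E c N k c₁ μZ f‖ ≤ ‖f‖ := by
  rw [cnstN_apply, Submodule.norm_coe]
  exact norm_condExpL2_le (invariantSigma_le F E c N) f

/-- `cnst f ∈ 𝓗^cusp ↔ cnst f = 0`. [cite: BernsteinLapid2019, §4 Claim 4 p. 10] -/
theorem cnstN_mem_HNcusp_iff (f : HN F E c N k c₁ μZ) : cnstN F E c N k c₁ μZ f ∈ HNcusp F E c N k c₁ μZ ↔ cnstN F E c N k c₁ μZ f = 0 := by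
  rw [mem_HNcusp_iff, cnstN_idem]

/-- **`f − cnst_k f ∈ 𝓗_k(Z_c)^cusp`** (the cuspidal part). [cite: BernsteinLapid2019, §4 Claim 4 p. 10] [cite: MoeglinWaldspurger1995, I.2.6] -/
theorem sub_cnstN_mem_HNcusp (f : HN F E c N k c₁ μZ) : f - cnstN F E c N k c₁ μZ f ∈ HNcusp F E c N k c₁ μZ := by
  rw [mem_HNcusp_iff, map_sub, cnstN_idem, sub_self]

/-- **The orthogonal splitting `f = (f − cnst f) + cnst f`** with `f − cnst f ∈ 𝓗^cusp` and `cnst f` `N(𝔸)`-invariant. [cite: BernsteinLapid2019, §4 Claim 4 p. 10] -/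
theorem eq_cusp_add_cnst (f : HN F E c N k c₁ μZ) :
    ∃ u ∈ HNcusp F E c N k c₁ μZ, ∃ v ∈ lpMeas ℂ ℂ (invariantSigma F E c N) 2 (weightedTruncMeasure F E c N k c₁ μZ), f = u + v :=
  ⟨f - cnstN F E c N k c₁ μZ f, sub_cnstN_mem_HNcusp f, cnstN F E c N k c₁ μZ f, cnstN_mem_lpMeas F E c N k c₁ μZ f, (sub_add_cancel f _).symm⟩

/-- The cuspidal part is orthogonal to the constant part: `⟪f − cnst f, cnst g⟫ = 0`. [cite: BernsteinLapid2019, §4 Claim 4 p. 10] -/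
theorem inner_sub_cnstN_cnstN (f g : HN F E c N k c₁ μZ) : @inner ℂ _ _ (f - cnstN F E c N k c₁ μZ f) (cnstN F E c N k c₁ μZ g) = 0 := by
  rw [← inner_cnstN_left_eq_right, map_sub, cnstN_idem, sub_self, inner_zero_left]

end Summit.HodgeConjecture.HodgeConjecture.Cruxes.H413.K2E1BLSpacesU2

end
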